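import Summits.CriticalPhenomena.PercolationContinuityZ3.Theorems.PercNearOneGluingNoHeavyLowerTailSahiTangentPrincipalBottom

/-!
# `NoHeavyLowerTail` (crux stmt-CriticalPhenomena-4575), Sahi programme: the tangent / contraction inequality at order 3 —
# **THE GENERAL FORM: arbitrary bottom sections with pairwise CONDITIONAL HARRIS** (what the thirteen-number lemma really needs)

Support file (Sahi cell, seat `prim-sahi-p1`, generation 49; `--supports stmt-CriticalPhenomena-4575`).  Pure proofs, no definitions, no
`sorry`, standard axioms.  Companion of `…SahiTangentPrincipalBottom` (same seat and generation), whose `tangent13_nonneg` it reuses.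

WHAT THE METHOD CONSUMES.  In `…SahiTangentPrincipalBottom` the three bottom sections are principal up-sets; but the thirteen-number lemma
only uses, about the bottoms under the bottom-layer weight `ν₀`: (H3) Harris, and (H4) for each slot `a`, HARRIS FOR THE OTHER TWO BOTTOMS
CONDITIONED ON THE BOTTOM OF SLOT `a`: `ν₀(U_a⁰∩U_b⁰)·ν₀(U_a⁰∩U_c⁰) ≤ ν₀(U_a⁰)·ν₀(U_a⁰∩U_b⁰∩U_c⁰)`.  Principal bottoms have (H4) by Blinovsky's
device (`fkg_upperSet_mass_principal`); other instances: bottoms depending on pairwise disjoint sets of coordinates under a product weight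
(conditional independence), nested bottoms (chains).  Conversely the census counterexamples to Conjecture T₃ on `{0,1}⁴ × coin` (W161: bottoms
`x_ax_b`, `x_cx_d` and a third bottom `⊇ x_ax_b ∨ x_cx_d`) violate exactly (H4) for the third slot (`1/36 > 5/432` at the cleanest witness).
This file states (H4) as three explicit hypotheses:
* `latticeE3_nonneg_of_condHarris` — `C₃ ≥ 0` for three up-sets from ONE conditional Harris inequality (the tree's Blinovsky reduction
  `latticeE3_condCov_le` read with a hypothesis in place of a principal slot); needed for the `p⁰`-term of the sections identity;
* `tangent_condHarrisBottom_masses` — `T₃ ≥ 0` in mass form for two dominated log-supermodular probability weights `ν₀ ≼ ν₁`, arbitrary top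
  up-sets `U ⊇ U₀`, `V ⊇ V₀`, `W ⊇ W₀` and bottoms `U₀, V₀, W₀` with (H4);
* `sahiE_three_sections_condHarrisBottom_ge` — the contraction inequality `p·E₃^{ν₁}(χ_U,χ_V,χ_W) ≤ E₃^{(p·ν₁,(1−p)·ν₀)}(F_U,F_V,F_W)`.
HONEST LABEL: for the percolation inequality R23 the bottoms are connection events of `G − e`, for which (H4) can fail (conditional Harris given
a connection fails on the 4-cycle, seat gen 48 memo §5); nothing here addresses that case, Sahi's `C_n`, Kahn's conjecture or the increasing
star. [this work]
-/

namespace Summit.CriticalPhenomena.PercolationContinuityZ3.Theorems.SahiTangent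

open Finset Function Literature.Combinatorics.Sahi2008
open Literature.Probability.LatticeModels (mass mass_nonneg mass_mono mass_univ fkg_upperSet_mass latticeE3 latticeE3_condCov_le)
open scoped BigOperators

noncomputable section

section CondHarris

variable {α : Type*} [DistribLattice α] [Fintype α] [DecidableEq α]

/-- `C₃` from ONE conditional Harris inequality: for up-sets `A, B, C` under a nonnegative log-supermodular weight, if
`m(A∩C)·m(B∩C) ≤ m(C)·m(A∩B∩C)` (Harris for `A, B` conditioned on `C`) then `latticeE3 μ A B C ≥ 0` — the proof of the tree's
`latticeE3_nonneg_of_principal` with the principal slot replaced by the hypothesis. [this work] -/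
theorem latticeE3_nonneg_of_condHarris {μ : α → ℝ} (hμ₀ : 0 ≤ μ) (hμ : ∀ a b, μ a * μ b ≤ μ (a ⊓ b) * μ (a ⊔ b))
    {A B C : Finset α} (hA : IsUpperSet (A : Set α)) (hB : IsUpperSet (B : Set α)) (hC : IsUpperSet (C : Set α))
    (hcond : mass μ (A ∩ C) * mass μ (B ∩ C) ≤ mass μ C * mass μ (A ∩ B ∩ C)) : 0 ≤ latticeE3 μ A B C := by
  have hred := latticeE3_condCov_le hμ₀ hμ hA hB hC
  have hZ := mass_nonneg hμ₀ (univ : Finset α)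
  have hc := mass_nonneg hμ₀ C
  have h0 : 0 ≤ mass μ C * latticeE3 μ A B C :=
    le_trans (mul_nonneg (pow_nonneg hZ 2) (sub_nonneg.2 (by linarith [hcond]))) hred
  rcases hc.eq_or_lt with h | h
  · have hzero : ∀ S : Finset α, mass μ (S ∩ C) = 0 := fun S =>
      le_antisymm (h ▸ mass_mono hμ₀ Finset.inter_subset_right) (mass_nonneg hμ₀ _)
    unfold latticeE3
    rw [← h, hzero (A ∩ B), hzero A, hzero B]
    ring_nf
    exact le_rfl
  · exact nonneg_of_mul_nonneg_right h0 h

/-- **`T₃ ≥ 0`, general bottoms, mass form.**  Two nonnegative log-supermodular probability weights `ν₀ ≼ ν₁` (domination on up-sets);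
top up-sets `U, V, W`, bottom up-sets `U₀ ⊆ U`, `V₀ ⊆ V`, `W₀ ⊆ W`; and, for each slot, Harris for the other two bottoms under `ν₀`
conditioned on that slot's bottom (`hcU`, `hcV`, `hcW`).  Then the tangent bracket is nonnegative. [this work] -/
theorem tangent_condHarrisBottom_masses {ν₀ ν₁ : α → ℝ} (h₀ : 0 ≤ ν₀) (hl₀ : ∀ a b, ν₀ a * ν₀ b ≤ ν₀ (a ⊓ b) * ν₀ (a ⊔ b))
    (hZ₀ : ∑ x, ν₀ x = 1) (h₁ : 0 ≤ ν₁) (hl₁ : ∀ a b, ν₁ a * ν₁ b ≤ ν₁ (a ⊓ b) * ν₁ (a ⊔ b)) (hZ₁ : ∑ x, ν₁ x = 1)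
    (hdom : ∀ A : Finset α, IsUpperSet (A : Set α) → mass ν₀ A ≤ mass ν₁ A)
    {U V W U₀ V₀ W₀ : Finset α} (hU : IsUpperSet (U : Set α)) (hV : IsUpperSet (V : Set α)) (hW : IsUpperSet (W : Set α))
    (hU₀ : IsUpperSet (U₀ : Set α)) (hV₀ : IsUpperSet (V₀ : Set α)) (hW₀ : IsUpperSet (W₀ : Set α))
    (huU : U₀ ⊆ U) (hvV : V₀ ⊆ V) (hwW : W₀ ⊆ W)
    (hcU : mass ν₀ (U₀ ∩ V₀) * mass ν₀ (U₀ ∩ W₀) ≤ mass ν₀ U₀ * mass ν₀ (U₀ ∩ V₀ ∩ W₀))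
    (hcV : mass ν₀ (U₀ ∩ V₀) * mass ν₀ (V₀ ∩ W₀) ≤ mass ν₀ V₀ * mass ν₀ (U₀ ∩ V₀ ∩ W₀))
    (hcW : mass ν₀ (U₀ ∩ W₀) * mass ν₀ (V₀ ∩ W₀) ≤ mass ν₀ W₀ * mass ν₀ (U₀ ∩ V₀ ∩ W₀)) :
    0 ≤ 2 * mass ν₀ (U₀ ∩ V₀ ∩ W₀)
      + (mass ν₁ U - mass ν₀ U₀) * mass ν₁ (V ∩ W)
      + (mass ν₁ V - mass ν₀ V₀) * mass ν₁ (U ∩ W)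
      + (mass ν₁ W - mass ν₀ W₀) * mass ν₁ (U ∩ V)
      + mass ν₀ U₀ * mass ν₁ V * mass ν₁ W
      + mass ν₀ V₀ * mass ν₁ U * mass ν₁ W
      + mass ν₀ W₀ * mass ν₁ U * mass ν₁ V
      - mass ν₁ U * mass ν₀ (V₀ ∩ W₀)
      - mass ν₁ V * mass ν₀ (U₀ ∩ W₀)
      - mass ν₁ W * mass ν₀ (U₀ ∩ V₀)
      - 2 * mass ν₁ U * mass ν₁ V * mass ν₁ W := by
  have hZ₀' : mass ν₀ univ = 1 := by rw [mass_univ]; exact hZ₀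
  have hZ₁' : mass ν₁ univ = 1 := by rw [mass_univ]; exact hZ₁
  have huv : IsUpperSet ((U₀ ∩ V₀ : Finset α) : Set α) := by rw [Finset.coe_inter]; exact hU₀.inter hV₀
  have huw : IsUpperSet ((U₀ ∩ W₀ : Finset α) : Set α) := by rw [Finset.coe_inter]; exact hU₀.inter hW₀
  have hvw : IsUpperSet ((V₀ ∩ W₀ : Finset α) : Set α) := by rw [Finset.coe_inter]; exact hV₀.inter hW₀
  -- (H1)
  have d₀ : mass ν₀ U₀ ≤ mass ν₁ U := (hdom _ hU₀).trans (mass_mono h₁ huU)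
  have d₁ : mass ν₀ V₀ ≤ mass ν₁ V := (hdom _ hV₀).trans (mass_mono h₁ hvV)
  have d₂ : mass ν₀ W₀ ≤ mass ν₁ W := (hdom _ hW₀).trans (mass_mono h₁ hwW)
  have d₀₁ : mass ν₀ (U₀ ∩ V₀) ≤ mass ν₁ (U ∩ V) := (hdom _ huv).trans (mass_mono h₁ (Finset.inter_subset_inter huU hvV))
  have d₀₂ : mass ν₀ (U₀ ∩ W₀) ≤ mass ν₁ (U ∩ W) := (hdom _ huw).trans (mass_mono h₁ (Finset.inter_subset_inter huU hwW))
  have d₁₂ : mass ν₀ (V₀ ∩ W₀) ≤ mass ν₁ (V ∩ W) := (hdom _ hvw).trans (mass_mono h₁ (Finset.inter_subset_inter hvV hwW))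
  -- (H2)
  have c₀₁ : mass ν₁ U * mass ν₁ V ≤ mass ν₁ (U ∩ V) := by
    have h := fkg_upperSet_mass h₁ hl₁ hU hV
    rw [hZ₁', one_mul] at h; exact h
  have c₀₂ : mass ν₁ U * mass ν₁ W ≤ mass ν₁ (U ∩ W) := by
    have h := fkg_upperSet_mass h₁ hl₁ hU hW
    rw [hZ₁', one_mul] at h; exact h
  have c₁₂ : mass ν₁ V * mass ν₁ W ≤ mass ν₁ (V ∩ W) := by
    have h := fkg_upperSet_mass h₁ hl₁ hV hW
    rw [hZ₁', one_mul] at h; exact h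
  -- (H3)
  have b₀ : mass ν₀ U₀ * mass ν₀ (V₀ ∩ W₀) ≤ mass ν₀ (U₀ ∩ V₀ ∩ W₀) := by
    have h := fkg_upperSet_mass h₀ hl₀ hU₀ hvw
    rw [hZ₀', one_mul, ← Finset.inter_assoc] at h; exact h
  have b₁ : mass ν₀ V₀ * mass ν₀ (U₀ ∩ W₀) ≤ mass ν₀ (U₀ ∩ V₀ ∩ W₀) := by
    have h := fkg_upperSet_mass h₀ hl₀ hV₀ huw
    rw [hZ₀', one_mul, Finset.inter_left_comm, ← Finset.inter_assoc] at h; exact h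
  have b₂ : mass ν₀ W₀ * mass ν₀ (U₀ ∩ V₀) ≤ mass ν₀ (U₀ ∩ V₀ ∩ W₀) := by
    have h := fkg_upperSet_mass h₀ hl₀ hW₀ huv
    rw [hZ₀', one_mul, Finset.inter_comm W₀ (U₀ ∩ V₀)] at h; exact h
  have key := tangent13_nonneg (mass_nonneg h₁ U) (mass_nonneg h₁ V) (mass_nonneg h₁ W) (mass_nonneg h₀ _) (mass_nonneg h₀ _)
    (mass_nonneg h₀ _) (mass_nonneg h₀ _) (mass_nonneg h₀ _) (mass_nonneg h₀ _) (mass_nonneg h₀ _)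
    d₀ d₁ d₂ d₀₁ d₀₂ d₁₂ c₀₁ c₀₂ c₁₂ b₀ b₁ b₂ hcU hcV hcW
  linarith [key]

/-- **THE CONTRACTION INEQUALITY, general bottoms.**  As `sahiE_three_sections_principalBottom_ge`, with the bottoms arbitrary up-sets
`U₀ ⊆ U`, `V₀ ⊆ V`, `W₀ ⊆ W` satisfying the three conditional Harris inequalities under `ν₀` (`hcU`, `hcV`, `hcW`):
`p · E₃^{ν₁}(χ_U, χ_V, χ_W) ≤ E₃^{(p·ν₁, (1−p)·ν₀)}(F_U, F_V, F_W)`. [this work] -/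
theorem sahiE_three_sections_condHarrisBottom_ge {ν₀ ν₁ : α → ℝ} (h₀ : 0 ≤ ν₀)
    (hl₀ : ∀ a b, ν₀ a * ν₀ b ≤ ν₀ (a ⊓ b) * ν₀ (a ⊔ b)) (hZ₀ : ∑ x, ν₀ x = 1) (h₁ : 0 ≤ ν₁)
    (hl₁ : ∀ a b, ν₁ a * ν₁ b ≤ ν₁ (a ⊓ b) * ν₁ (a ⊔ b)) (hZ₁ : ∑ x, ν₁ x = 1)
    (hdom : ∀ A : Finset α, IsUpperSet (A : Set α) → mass ν₀ A ≤ mass ν₁ A)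
    {U V W U₀ V₀ W₀ : Finset α} (hU : IsUpperSet (U : Set α)) (hV : IsUpperSet (V : Set α)) (hW : IsUpperSet (W : Set α))
    (hU₀ : IsUpperSet (U₀ : Set α)) (hV₀ : IsUpperSet (V₀ : Set α)) (hW₀ : IsUpperSet (W₀ : Set α))
    (huU : U₀ ⊆ U) (hvV : V₀ ⊆ V) (hwW : W₀ ⊆ W)
    (hcU : mass ν₀ (U₀ ∩ V₀) * mass ν₀ (U₀ ∩ W₀) ≤ mass ν₀ U₀ * mass ν₀ (U₀ ∩ V₀ ∩ W₀))
    (hcV : mass ν₀ (U₀ ∩ V₀) * mass ν₀ (V₀ ∩ W₀) ≤ mass ν₀ V₀ * mass ν₀ (U₀ ∩ V₀ ∩ W₀))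
    (hcW : mass ν₀ (U₀ ∩ W₀) * mass ν₀ (V₀ ∩ W₀) ≤ mass ν₀ W₀ * mass ν₀ (U₀ ∩ V₀ ∩ W₀))
    {p : ℝ} (hp₀ : 0 ≤ p) (hp₁ : p ≤ 1) :
    p * sahiE ν₁ 3 ![setInd U, setInd V, setInd W] ≤
      sahiE (fun z : Bool × α => if z.1 then p * ν₁ z.2 else (1 - p) * ν₀ z.2) 3
        ![fun z => if z.1 then setInd U z.2 else setInd U₀ z.2,
          fun z => if z.1 then setInd V z.2 else setInd V₀ z.2,
          fun z => if z.1 then setInd W z.2 else setInd W₀ z.2] := by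
  have key := sahiE_three_sections ν₀ ν₁ p
    ![fun z => if z.1 then setInd U z.2 else setInd U₀ z.2,
      fun z => if z.1 then setInd V z.2 else setInd V₀ z.2,
      fun z => if z.1 then setInd W z.2 else setInd W₀ z.2]
  simp only [Matrix.cons_val_zero, Matrix.cons_val_one, Matrix.cons_val_two, Matrix.head_cons, Matrix.tail_cons,
    if_true, if_false, Bool.false_eq_true] at key
  have e0 : (fun x => setInd U x) = setInd U := rfl
  have e1 : (fun x => setInd V x) = setInd V := rfl
  have e2 : (fun x => setInd W x) = setInd W := rfl
  have e3 : (fun x => setInd U₀ x) = setInd U₀ := rfl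
  have e4 : (fun x => setInd V₀ x) = setInd V₀ := rfl
  have e5 : (fun x => setInd W₀ x) = setInd W₀ := rfl
  have m1 : (fun x => setInd U₀ x * setInd V₀ x * setInd W₀ x) = setInd U₀ * setInd V₀ * setInd W₀ := rfl
  have m2 : (fun x => setInd V x * setInd W x) = setInd V * setInd W := rfl
  have m3 : (fun x => setInd U x * setInd W x) = setInd U * setInd W := rfl
  have m4 : (fun x => setInd U x * setInd V x) = setInd U * setInd V := rfl
  have m5 : (fun x => setInd V₀ x * setInd W₀ x) = setInd V₀ * setInd W₀ := rfl
  have m6 : (fun x => setInd U₀ x * setInd W₀ x) = setInd U₀ * setInd W₀ := rfl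
  have m7 : (fun x => setInd U₀ x * setInd V₀ x) = setInd U₀ * setInd V₀ := rfl
  rw [e0, e1, e2, e3, e4, e5, m1, m2, m3, m4, m5, m6, m7] at key
  simp only [setInd_mul, ex_setInd] at key
  have hT := tangent_condHarrisBottom_masses h₀ hl₀ hZ₀ h₁ hl₁ hZ₁ hdom hU hV hW hU₀ hV₀ hW₀ huU hvV hwW hcU hcV hcW
  have hc₀ : 0 ≤ sahiE ν₀ 3 ![setInd U₀, setInd V₀, setInd W₀] := by
    rw [sahiE_three_indicator_eq_latticeE3 hZ₀]
    exact latticeE3_nonneg_of_condHarris h₀ hl₀ hU₀ hV₀ hW₀ hcW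
  have hD : 0 ≤ (mass ν₁ U - mass ν₀ U₀) * (mass ν₁ V - mass ν₀ V₀) * (mass ν₁ W - mass ν₀ W₀) :=
    mul_nonneg (mul_nonneg (sub_nonneg.2 ((hdom _ hU₀).trans (mass_mono h₁ huU)))
      (sub_nonneg.2 ((hdom _ hV₀).trans (mass_mono h₁ hvV)))) (sub_nonneg.2 ((hdom _ hW₀).trans (mass_mono h₁ hwW)))
  have h1p : 0 ≤ 1 - p := sub_nonneg.2 hp₁
  nlinarith [key, mul_nonneg h1p (mul_nonneg h1p hc₀), mul_nonneg h1p (mul_nonneg hp₀ hT),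
    mul_nonneg h1p (mul_nonneg (mul_nonneg hp₀ h1p) hD)]

end CondHarris

end

end Summit.CriticalPhenomena.PercolationContinuityZ3.Theorems.SahiTangent
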